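import Literature.MathematicalPhysics.QuantumFieldTheory.Balaban1983to89.B12Decay510
import Literature.Analysis.Complex.SeveralVariables

/-!
# `Balaban1983to89.B12Decay510Holo` — the (4.3)–(4.5) Cauchy bilinear estimate and the (5.10) chain in
# HOLOMORPHIC (`DifferentiableOn ℂ`) currency instead of `AnalyticOnNhd ℂ`

Cell pub-balaban, β-function sub-cell, BINDER row D4 (unit `b2b-balaban-beta-an4` gen 49, row D4 OWNER).

WHY.  [Balaban1987RG1] p. 281 (4.4): *"Thus it is defined and analytic on the space of configurations 𝐀 satisfying
max{|𝐀|_X, |P₁(□₀)𝐀|_X, |∇^ξ𝐀|_X, |Δ^ξ𝐀|_X} < α₂"* — and the only use print makes of this analyticity is the CAUCHY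
ESTIMATE (4.5) for the second 𝐀-derivative (4.3).  The kernel chain `B12Decay510` (§8, `norm_mixedDeriv_le`,
`qBound_of_analytic`, `decay510_of_analytic_leaves`) typed the hypothesis as Mathlib's `AnalyticOnNhd ℂ E (ball 0 α₂)`
(power-series analyticity on the Banach ball).  Every PRODUCER of such functionals in the tree, however, delivers
complex FRÉCHET differentiability on open sets — `DifferentiableOn ℂ` — and not power series: the Kotecký–Preiss
logarithm in a Banach parameter `PolymerPressureAnalytic.differentiableOn_polymerLogZ_param`, the cluster expansions of
`Dimock2011to13.ClusterExpansionAnalytic`, the T⁴ one-step envelope `T4InputCauchyRateData.StepModel.OutputEnvelope`;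
and on a complex Banach domain Mathlib has no `DifferentiableOn → AnalyticOnNhd` (only for domain ℂ,
`DifferentiableOn.analyticOnNhd`; the several-variable file `Literature.Analysis.Complex.SeveralVariables` records the
absence of Osgood/Hartogs).  This module re-derives the (4.3)–(4.5) calculus and the (5.10) chain from
`DifferentiableOn ℂ E (ball 0 α₂)` ALONE, using `SCV.differentiableOn_fderiv_apply` (directional derivatives of
holomorphic maps are holomorphic — Cauchy formula along complex lines, any Banach domain) in the one place where
`B12Decay510` used analyticity of the Fréchet derivative.  Nothing else changes: same constants, same shapes.  So the
row-D4 socket's leaf `han` can be fed in the currency the producers have (record `HOME/b2b-balaban-beta-an4/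
D4-CRUX-SOCKETS.md` v1.1, design point M1′).

WHAT IS PROVED (all [folklore] calculus + the printed (4.5)/(5.10) shapes; 0 sorry):
* §1 `mixedDeriv_eq_fderiv_apply`: ∂²E(a, b) = D[𝐀 ↦ DE(𝐀)a](0) b; bilinearity `mixedDeriv_add_left/right`,
  `mixedDeriv_smul_left/right`, `mixedDeriv_sub_left/right` — from `DifferentiableOn` on a ball around 0.
* §2 the Cauchy bilinear estimate `norm_mixedDeriv_le_of_closedBall_of_differentiableOn` /
  `norm_mixedDeriv_le_of_differentiableOn`: ‖∂²E(a, b)‖ ≤ 4Sα⁻²‖a‖‖b‖ ([I] (4.5) at r = n = 2), and the joint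
  continuity `tendsto_mixedDeriv_of_differentiableOn` (bounded bilinear ⇒ continuous; replaces the
  `DifferentiableAt ℂ (fderiv ℂ F) 0` route of `RemainderLocality.tendsto_mixedDeriv`, which needs C², i.e. analyticity
  or finite dimension).
* §3 `qBound_of_differentiableOn` (the leaf `hQ` of `B12Decay510.kernelBound_of_repr435` with A = 4E₀α₂⁻²) and
  `decay510_of_differentiable_leaves` (= `decay510_of_analytic_leaves` with `han` weakened to `hdiff`).
* §4 (an `example`): the new hypotheses are WEAKER than the old (`AnalyticOnNhd.differentiableOn`).
HONEST FRAMING: bookkeeping/calculus over the unmodified carriers; nothing of Bałaban's asserted; (D4) NOT discharged;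
NOT BetaPertH, NOT continuum, NOT Clay.  HONEST DEPENDENCY: continuum YM on T⁴ ⇐ BetaPertH ∧ nine spine estimates
(0/9 proved); BetaPertH ⇐ (D1) ∧ (D4) ∧ CAP+tail; G-an2-4 gates asym, D1 and NE2/3/4.
-/

noncomputable section

open Metric Filter Topology Set

namespace Literature.MathematicalPhysics.QuantumFieldTheory.Balaban1983to89.B12Decay510Holo

open Literature.MathematicalPhysics.QuantumFieldTheory.Balaban1983to89
open Literature.MathematicalPhysics.QuantumFieldTheory.Balaban1983to89.B12Decay510
open Literature.Analysis.Complex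

variable {W : Type*} [NormedAddCommGroup W] [NormedSpace ℂ W]

/-! ## §1 The mixed derivative (4.3) from Fréchet differentiability on the (4.4)-ball: formula and bilinearity -/

/-- For E holomorphic on the ball ‖𝐀‖ < α, the directional derivative 𝐀 ↦ DE(𝐀)a is differentiable at every point
of the ball (Cauchy formula along complex lines, `SCV.differentiableOn_fderiv_apply`). [folklore] -/
private theorem differentiableAt_fderiv_apply {E : W → ℂ} {α : ℝ} (hE : DifferentiableOn ℂ E (ball 0 α)) (a : W) {v : W}
    (hv : v ∈ ball (0 : W) α) : DifferentiableAt ℂ (fun w => fderiv ℂ E w a) v :=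
  (SCV.differentiableOn_fderiv_apply hE isOpen_ball a).differentiableAt (isOpen_ball.mem_nhds hv)

/-- **(4.3) as an iterated directional derivative**: ∂²/∂τ₁∂τ₂ E(τ₁a + τ₂b)∣₀ = D[𝐀 ↦ DE(𝐀)a](0) b for E holomorphic
on ‖𝐀‖ < α (chain rule along τ ↦ τb). [cite: Balaban1987RG1, (4.3) p.281] -/
theorem mixedDeriv_eq_fderiv_apply {E : W → ℂ} {α : ℝ} (hα : 0 < α) (hE : DifferentiableOn ℂ E (ball 0 α))
    (a b : W) : mixedDeriv E a b = fderiv ℂ (fun w => fderiv ℂ E w a) 0 b := by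
  have hG : DifferentiableAt ℂ (fun w => fderiv ℂ E w a) ((0 : ℂ) • b) := by
    rw [zero_smul]; exact differentiableAt_fderiv_apply hE a (mem_ball_self hα)
  have hφ : HasDerivAt (fun τ : ℂ => τ • b) b 0 := by
    simpa using (hasDerivAt_id (0 : ℂ)).smul_const b
  have hc : HasDerivAt (fun τ : ℂ => fderiv ℂ E (τ • b) a) (fderiv ℂ (fun w => fderiv ℂ E w a) ((0 : ℂ) • b) b) 0 :=
    HasFDerivAt.comp_hasDerivAt_of_eq (hl := hG.hasFDerivAt) (hf := hφ) (hy := rfl)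
  unfold mixedDeriv
  rw [hc.deriv, zero_smul]

/-- Additivity of (4.3) in the first direction, from holomorphy on (4.4).  ((4.3)/(1.20): the second 𝐀-derivative is a BILINEAR form in the pair of directions — the
form ⟨·, Π ·⟩ of (4.35).) [cite: Balaban1987RG1, (4.3) p.281 and (1.20) p.264] -/
theorem mixedDeriv_add_left {E : W → ℂ} {α : ℝ} (hα : 0 < α) (hE : DifferentiableOn ℂ E (ball 0 α))
    (a₁ a₂ b : W) : mixedDeriv E (a₁ + a₂) b = mixedDeriv E a₁ b + mixedDeriv E a₂ b := by
  have h1 := differentiableAt_fderiv_apply hE a₁ (mem_ball_self hα)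
  have h2 := differentiableAt_fderiv_apply hE a₂ (mem_ball_self hα)
  rw [mixedDeriv_eq_fderiv_apply hα hE, mixedDeriv_eq_fderiv_apply hα hE, mixedDeriv_eq_fderiv_apply hα hE]
  have hsum : (fun w => fderiv ℂ E w (a₁ + a₂)) = (fun w => fderiv ℂ E w a₁) + fun w => fderiv ℂ E w a₂ := by
    funext w; simp only [map_add, Pi.add_apply]
  rw [hsum, fderiv_add h1 h2]; rfl

/-- Homogeneity of (4.3) in the first direction, from holomorphy on (4.4).  ((4.3)/(1.20): the second 𝐀-derivative is a BILINEAR form in the pair of directions — the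
form ⟨·, Π ·⟩ of (4.35).) [cite: Balaban1987RG1, (4.3) p.281 and (1.20) p.264] -/
theorem mixedDeriv_smul_left {E : W → ℂ} {α : ℝ} (hα : 0 < α) (hE : DifferentiableOn ℂ E (ball 0 α))
    (c : ℂ) (a b : W) : mixedDeriv E (c • a) b = c * mixedDeriv E a b := by
  have h1 := differentiableAt_fderiv_apply hE a (mem_ball_self hα)
  rw [mixedDeriv_eq_fderiv_apply hα hE, mixedDeriv_eq_fderiv_apply hα hE]
  have hsm : (fun w => fderiv ℂ E w (c • a)) = c • fun w => fderiv ℂ E w a := by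
    funext w; simp only [map_smul, smul_eq_mul, Pi.smul_apply]
  rw [hsm, fderiv_const_smul h1]; rfl

/-- Additivity of (4.3) in the second direction, from holomorphy on (4.4).  ((4.3)/(1.20): the second 𝐀-derivative is a BILINEAR form in the pair of directions — the
form ⟨·, Π ·⟩ of (4.35).) [cite: Balaban1987RG1, (4.3) p.281 and (1.20) p.264] -/
theorem mixedDeriv_add_right {E : W → ℂ} {α : ℝ} (hα : 0 < α) (hE : DifferentiableOn ℂ E (ball 0 α))
    (a b₁ b₂ : W) : mixedDeriv E a (b₁ + b₂) = mixedDeriv E a b₁ + mixedDeriv E a b₂ := by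
  simp only [mixedDeriv_eq_fderiv_apply hα hE, map_add]

/-- Homogeneity of (4.3) in the second direction, from holomorphy on (4.4).  ((4.3)/(1.20): the second 𝐀-derivative is a BILINEAR form in the pair of directions — the
form ⟨·, Π ·⟩ of (4.35).) [cite: Balaban1987RG1, (4.3) p.281 and (1.20) p.264] -/
theorem mixedDeriv_smul_right {E : W → ℂ} {α : ℝ} (hα : 0 < α) (hE : DifferentiableOn ℂ E (ball 0 α))
    (c : ℂ) (a b : W) : mixedDeriv E a (c • b) = c * mixedDeriv E a b := by
  simp only [mixedDeriv_eq_fderiv_apply hα hE, map_smul, smul_eq_mul]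

/-- (4.3) of a difference of first directions, from holomorphy on (4.4).  ((4.3)/(1.20): the second 𝐀-derivative is a BILINEAR form in the pair of directions — the
form ⟨·, Π ·⟩ of (4.35).) [cite: Balaban1987RG1, (4.3) p.281 and (1.20) p.264] -/
theorem mixedDeriv_sub_left {E : W → ℂ} {α : ℝ} (hα : 0 < α) (hE : DifferentiableOn ℂ E (ball 0 α))
    (a₁ a₂ b : W) : mixedDeriv E (a₁ - a₂) b = mixedDeriv E a₁ b - mixedDeriv E a₂ b := by
  rw [sub_eq_add_neg, mixedDeriv_add_left hα hE, ← neg_one_smul ℂ a₂, mixedDeriv_smul_left hα hE]; ring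

/-- (4.3) of a difference of second directions, from holomorphy on (4.4).  ((4.3)/(1.20): the second 𝐀-derivative is a BILINEAR form in the pair of directions — the
form ⟨·, Π ·⟩ of (4.35).) [cite: Balaban1987RG1, (4.3) p.281 and (1.20) p.264] -/
theorem mixedDeriv_sub_right {E : W → ℂ} {α : ℝ} (hα : 0 < α) (hE : DifferentiableOn ℂ E (ball 0 α))
    (a b₁ b₂ : W) : mixedDeriv E a (b₁ - b₂) = mixedDeriv E a b₁ - mixedDeriv E a b₂ := by
  simp only [mixedDeriv_eq_fderiv_apply hα hE, map_sub]

/-- The replacement identity ∂²E(a₁, b₁) − ∂²E(a₂, b₂) = ∂²E(a₁ − a₂, b₁) + ∂²E(a₂, b₁ − b₂), from holomorphy on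
(4.4) (bilinearity of the (4.3)/(4.35) form; twin of `B12HjFree290.mixedDeriv_sub_sub`).
[cite: Balaban1987RG1, (4.3) p.281 and (4.35) p.290] -/
theorem mixedDeriv_sub_sub {E : W → ℂ} {α : ℝ} (hα : 0 < α) (hE : DifferentiableOn ℂ E (ball 0 α))
    (a₁ b₁ a₂ b₂ : W) :
    mixedDeriv E a₁ b₁ - mixedDeriv E a₂ b₂ = mixedDeriv E (a₁ - a₂) b₁ + mixedDeriv E a₂ (b₁ - b₂) := by
  rw [mixedDeriv_sub_left hα hE, mixedDeriv_sub_right hα hE]; ring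

/-! ## §2 The Cauchy bilinear estimate (4.5), r = n = 2, from Fréchet differentiability -/

/-- **(F) The Cauchy estimate behind (4.5), r = n = 2, on a closed sub-ball — HOLOMORPHIC CURRENCY.**  IF E is complex
Fréchet-differentiable on the open ball ‖𝐀‖ < α ((4.4) p. 281) and ∣E∣ ≤ S on the closed ball of radius ρ < α
((1.18) p. 263 on that domain), THEN ∣∂²/∂τ₁∂τ₂ E(τ₁a + τ₂b)∣₀∣ ≤ 4Sρ⁻²‖a‖‖b‖: the third form of (4.3) estimated on
the circles ∣τ₁∣ = ρ/(2‖a‖), ∣τ₂∣ = ρ/(2‖b‖), each circle costing a factor radius⁻¹.  Same proof as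
`B12Decay510.norm_mixedDeriv_le_of_closedBall`; the differentiability of τ ↦ DE(τb)a, there taken from the analyticity
of the Fréchet derivative, is here `SCV.differentiableOn_fderiv_apply`. [cite: Balaban1987RG1, (4.3)-(4.5) pp.281-282] -/
theorem norm_mixedDeriv_le_of_closedBall_of_differentiableOn {E : W → ℂ} {α ρ S : ℝ}
    (hE : DifferentiableOn ℂ E (ball 0 α)) (hρ : 0 < ρ) (hρα : ρ < α)
    (hS : ∀ v ∈ closedBall (0 : W) ρ, ‖E v‖ ≤ S) (a b : W) :
    ‖mixedDeriv E a b‖ ≤ 4 * S / ρ ^ 2 * ‖a‖ * ‖b‖ := by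
  have hS0 : 0 ≤ S := (norm_nonneg _).trans (hS 0 (mem_closedBall_self hρ.le))
  have hball : closedBall (0 : W) ρ ⊆ ball 0 α := closedBall_subset_ball hρα
  have hdiffE : ∀ v ∈ closedBall (0 : W) ρ, DifferentiableAt ℂ E v :=
    fun v hv => hE.differentiableAt (isOpen_ball.mem_nhds (hball hv))
  by_cases ha : a = 0
  · subst ha
    have : mixedDeriv E 0 b = 0 := by simp [mixedDeriv]
    rw [this, norm_zero]; positivity
  by_cases hb : b = 0
  · subst hb
    have : mixedDeriv E a 0 = 0 := by simp [mixedDeriv]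
    rw [this, norm_zero]; positivity
  have ha' : 0 < ‖a‖ := norm_pos_iff.2 ha
  have hb' : 0 < ‖b‖ := norm_pos_iff.2 hb
  set r₁ : ℝ := ρ / (2 * ‖a‖) with hr₁
  set r₂ : ℝ := ρ / (2 * ‖b‖) with hr₂
  have hr₁0 : 0 < r₁ := div_pos hρ (by positivity)
  have hr₂0 : 0 < r₂ := div_pos hρ (by positivity)
  have hin : ∀ τ₁ τ₂ : ℂ, ‖τ₁‖ ≤ r₁ → ‖τ₂‖ ≤ r₂ → τ₁ • a + τ₂ • b ∈ closedBall (0 : W) ρ := by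
    intro τ₁ τ₂ h1 h2
    rw [mem_closedBall, dist_zero_right]
    calc ‖τ₁ • a + τ₂ • b‖ ≤ ‖τ₁ • a‖ + ‖τ₂ • b‖ := norm_add_le _ _
      _ = ‖τ₁‖ * ‖a‖ + ‖τ₂‖ * ‖b‖ := by rw [norm_smul, norm_smul]
      _ ≤ r₁ * ‖a‖ + r₂ * ‖b‖ := by gcongr
      _ = ρ := by rw [hr₁, hr₂]; field_simp; ring
  -- the inner Cauchy estimate (circle in τ₁ at fixed τ₂): ‖DE(τ₂b) a‖ ≤ S / r₁ for ‖τ₂‖ ≤ r₂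
  have inner : ∀ τ₂ : ℂ, ‖τ₂‖ ≤ r₂ → ‖(fderiv ℂ E (τ₂ • b)) a‖ ≤ S / r₁ := by
    intro τ₂ h2
    have hp : τ₂ • b ∈ closedBall (0 : W) ρ := by simpa using hin 0 τ₂ (by simpa using hr₁0.le) h2
    rw [← deriv_line E a (τ₂ • b) (hdiffE _ hp)]
    refine Complex.norm_deriv_le_of_forall_mem_sphere_norm_le hr₁0 ?_ ?_
    · refine DifferentiableOn.diffContOnCl ?_
      rw [closure_ball (0 : ℂ) hr₁0.ne']
      intro τ₁ h1
      rw [mem_closedBall, dist_zero_right] at h1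
      have hd := hdiffE _ (hin τ₁ τ₂ h1 h2)
      have hlin : DifferentiableAt ℂ (fun τ : ℂ => τ • a + τ₂ • b) τ₁ :=
        (differentiableAt_id.smul_const a).add_const _
      exact (hd.comp τ₁ hlin).differentiableWithinAt
    · intro τ₁ h1
      rw [mem_sphere, dist_zero_right] at h1
      exact hS _ (hin τ₁ τ₂ h1.le h2)
  -- the outer Cauchy estimate (circle in τ₂); holomorphy of τ ↦ DE(τb)a from `SCV.differentiableOn_fderiv_apply`
  have outer : ‖mixedDeriv E a b‖ ≤ S / r₁ / r₂ := by
    unfold mixedDeriv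
    refine Complex.norm_deriv_le_of_forall_mem_sphere_norm_le hr₂0 ?_ ?_
    · refine DifferentiableOn.diffContOnCl ?_
      rw [closure_ball (0 : ℂ) hr₂0.ne']
      intro τ₂ h2
      rw [mem_closedBall, dist_zero_right] at h2
      have hp : τ₂ • b ∈ closedBall (0 : W) ρ := by simpa using hin 0 τ₂ (by simpa using hr₁0.le) h2
      have hG : DifferentiableAt ℂ (fun τ : ℂ => fderiv ℂ E (τ • b) a) τ₂ :=
        (differentiableAt_fderiv_apply hE a (hball hp)).comp τ₂ (differentiableAt_id.smul_const b)
      exact hG.differentiableWithinAt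
    · intro τ₂ h2
      rw [mem_sphere, dist_zero_right] at h2
      exact inner τ₂ h2.le
  calc ‖mixedDeriv E a b‖ ≤ S / r₁ / r₂ := outer
    _ = 4 * S / ρ ^ 2 * ‖a‖ * ‖b‖ := by rw [hr₁, hr₂]; field_simp; ring

/-- **(F) The Cauchy bilinear estimate, radius α₂ itself — HOLOMORPHIC CURRENCY**: E complex-differentiable on
‖𝐀‖ < α ((4.4)) with ∣E∣ ≤ S there ((1.18)) ⇒ ∣∂²/∂τ₁∂τ₂ E(τ₁a + τ₂b)∣₀∣ ≤ 4Sα⁻²‖a‖‖b‖ (the closed-sub-ball bound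
for every ρ < α, then ρ ↑ α).  [cite: Balaban1987RG1, (4.5) p.282] -/
theorem norm_mixedDeriv_le_of_differentiableOn {E : W → ℂ} {α S : ℝ} (hα : 0 < α)
    (hE : DifferentiableOn ℂ E (ball 0 α)) (hS : ∀ v ∈ ball (0 : W) α, ‖E v‖ ≤ S) (a b : W) :
    ‖mixedDeriv E a b‖ ≤ 4 * S / α ^ 2 * ‖a‖ * ‖b‖ := by
  have key : ∀ ρ, 0 < ρ → ρ < α → ‖mixedDeriv E a b‖ ≤ 4 * S / ρ ^ 2 * ‖a‖ * ‖b‖ :=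
    fun ρ h1 h2 => norm_mixedDeriv_le_of_closedBall_of_differentiableOn hE h1 h2
      (fun v hv => hS v (closedBall_subset_ball h2 hv)) a b
  have hc : ContinuousAt (fun ρ : ℝ => 4 * S / ρ ^ 2 * ‖a‖ * ‖b‖) α := by
    have hne : α ^ 2 ≠ 0 := pow_ne_zero 2 hα.ne'
    exact ((continuousAt_const.div (continuousAt_id.pow 2) (by simpa using hne)).mul
      continuousAt_const).mul continuousAt_const
  have ht : Tendsto (fun ρ : ℝ => 4 * S / ρ ^ 2 * ‖a‖ * ‖b‖) (𝓝[<] α)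
      (𝓝 (4 * S / α ^ 2 * ‖a‖ * ‖b‖)) := hc.tendsto.mono_left nhdsWithin_le_nhds
  refine ge_of_tendsto ht ?_
  have h1 : ∀ᶠ ρ in 𝓝[<] α, ρ ∈ Set.Iio α := eventually_mem_nhdsWithin
  have h2 : ∀ᶠ ρ in 𝓝[<] α, 0 < ρ := (eventually_gt_nhds hα).filter_mono nhdsWithin_le_nhds
  filter_upwards [h1, h2] with ρ hρα hρ using key ρ hρ hρα

/-- **The Cauchy estimate of the replacement — HOLOMORPHIC CURRENCY**: ‖∂²E(a₁, b₁) − ∂²E(a₂, b₂)‖ ≤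
4Sα⁻²(‖a₁ − a₂‖‖b₁‖ + ‖a₂‖‖b₁ − b₂‖) (twin of `B12HjFree290.norm_mixedDeriv_sub_le`).
[cite: Balaban1987RG1, (4.3)-(4.5) pp.281-282] -/
theorem norm_mixedDeriv_sub_le_of_differentiableOn {E : W → ℂ} {α S : ℝ} (hα : 0 < α)
    (hE : DifferentiableOn ℂ E (ball 0 α)) (hS : ∀ v ∈ ball (0 : W) α, ‖E v‖ ≤ S) (a₁ b₁ a₂ b₂ : W) :
    ‖mixedDeriv E a₁ b₁ - mixedDeriv E a₂ b₂‖ ≤ 4 * S / α ^ 2 * (‖a₁ - a₂‖ * ‖b₁‖ + ‖a₂‖ * ‖b₁ - b₂‖) := by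
  rw [mixedDeriv_sub_sub hα hE]
  have h1 := norm_mixedDeriv_le_of_differentiableOn hα hE hS (a₁ - a₂) b₁
  have h2 := norm_mixedDeriv_le_of_differentiableOn hα hE hS a₂ (b₁ - b₂)
  calc ‖mixedDeriv E (a₁ - a₂) b₁ + mixedDeriv E a₂ (b₁ - b₂)‖
      ≤ ‖mixedDeriv E (a₁ - a₂) b₁‖ + ‖mixedDeriv E a₂ (b₁ - b₂)‖ := norm_add_le _ _
    _ ≤ 4 * S / α ^ 2 * ‖a₁ - a₂‖ * ‖b₁‖ + 4 * S / α ^ 2 * ‖a₂‖ * ‖b₁ - b₂‖ := add_le_add h1 h2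
    _ = 4 * S / α ^ 2 * (‖a₁ - a₂‖ * ‖b₁‖ + ‖a₂‖ * ‖b₁ - b₂‖) := by ring

/-- **(K3″) in HOLOMORPHIC CURRENCY — limits pass through the mixed derivative**: a_i → a, b_i → b ⟹
∂²E(a_i, b_i) → ∂²E(a, b), for E complex-differentiable and bounded on the (4.4)-ball (bounded bilinear ⇒ jointly
continuous; replaces `RemainderLocality.tendsto_mixedDeriv`, whose hypothesis `DifferentiableAt ℂ (fderiv ℂ F) 0` is
C², i.e. analyticity or finite dimension).  This is the step *"Now we take a limit of these functions as
T^{(j+1)} ↗ Z^d"* for the bilinear forms (1.20)/(4.35) along convergent test configurations.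
[cite: Balaban1987RG1, (1.21) p.264 and (4.35) p.290] -/
theorem tendsto_mixedDeriv_of_differentiableOn {E : W → ℂ} {α S : ℝ} (hα : 0 < α)
    (hE : DifferentiableOn ℂ E (ball 0 α)) (hS : ∀ v ∈ ball (0 : W) α, ‖E v‖ ≤ S) {ι : Type*} {l : Filter ι}
    {u v : ι → W} {a b : W} (hu : Tendsto u l (𝓝 a)) (hv : Tendsto v l (𝓝 b)) :
    Tendsto (fun i => mixedDeriv E (u i) (v i)) l (𝓝 (mixedDeriv E a b)) := by
  rw [tendsto_iff_norm_sub_tendsto_zero]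
  have hS0 : 0 ≤ S := (norm_nonneg _).trans (hS 0 (mem_ball_self hα))
  have hbound : ∀ i, ‖mixedDeriv E (u i) (v i) - mixedDeriv E a b‖ ≤
      4 * S / α ^ 2 * (‖u i - a‖ * ‖v i‖ + ‖a‖ * ‖v i - b‖) :=
    fun i => norm_mixedDeriv_sub_le_of_differentiableOn hα hE hS (u i) (v i) a b
  have hlim : Tendsto (fun i => 4 * S / α ^ 2 * (‖u i - a‖ * ‖v i‖ + ‖a‖ * ‖v i - b‖)) l (𝓝 0) := by
    have h1 : Tendsto (fun i => ‖u i - a‖) l (𝓝 0) := tendsto_iff_norm_sub_tendsto_zero.1 hu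
    have h2 : Tendsto (fun i => ‖v i - b‖) l (𝓝 0) := tendsto_iff_norm_sub_tendsto_zero.1 hv
    have h3 : Tendsto (fun i => ‖v i‖) l (𝓝 ‖b‖) := hv.norm
    have : Tendsto (fun i => 4 * S / α ^ 2 * (‖u i - a‖ * ‖v i‖ + ‖a‖ * ‖v i - b‖)) l
        (𝓝 (4 * S / α ^ 2 * (0 * ‖b‖ + ‖a‖ * 0))) :=
      ((h1.mul h3).add (h2.const_mul _)).const_mul _
    simpa using this
  exact squeeze_zero (fun i => norm_nonneg _) hbound hlim

/-! ## §3 The leaf `hQ` and the (5.10) chain with the Cauchy leaf discharged in holomorphic currency -/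

variable {S : LocDomainSys}

/-- **(F) ⇒ the leaf `hQ` of (B) — HOLOMORPHIC CURRENCY**: for the family E_X = [𝐀 ↦ 𝐄^{(j)}(X, exp iξ𝐀)],
complex-differentiable on (4.4) with the bound (1.18) ∣E_X∣ ≤ E₀e^{−κd_j(X)} there, the real kernel
Q_X(a, b) = Re ∂²/∂τ₁∂τ₂ E_X(τ₁a + τ₂b)∣₀ obeys ∣Q_X(a, b)∣ ≤ 4E₀α₂⁻² e^{−κd_j(X)} ‖a‖‖b‖ (twin of
`B12Decay510.qBound_of_analytic`). [cite: Balaban1987RG1, (1.18) p.263 and (4.3)-(4.5) pp.281-282] -/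
theorem qBound_of_differentiableOn (EX : S.Dom → W → ℂ) {α₂ E₀ κ : ℝ} (hα₂ : 0 < α₂)
    (hdiff : ∀ X, DifferentiableOn ℂ (EX X) (ball 0 α₂))
    (h118 : ∀ X, ∀ v ∈ ball (0 : W) α₂, ‖EX X v‖ ≤ E₀ * Real.exp (-κ * S.dj X)) (X : S.Dom) (a b : W) :
    |(mixedDeriv (EX X) a b).re| ≤ 4 * E₀ / α₂ ^ 2 * Real.exp (-κ * S.dj X) * ‖a‖ * ‖b‖ :=
  calc |(mixedDeriv (EX X) a b).re| ≤ ‖mixedDeriv (EX X) a b‖ := Complex.abs_re_le_norm _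
    _ ≤ 4 * (E₀ * Real.exp (-κ * S.dj X)) / α₂ ^ 2 * ‖a‖ * ‖b‖ :=
      norm_mixedDeriv_le_of_differentiableOn hα₂ (hdiff X) (h118 X) a b
    _ = 4 * E₀ / α₂ ^ 2 * Real.exp (-κ * S.dj X) * ‖a‖ * ‖b‖ := by ring

/-- **The whole (5.10) chain with the Cauchy leaf discharged in HOLOMORPHIC CURRENCY** (twin of
`B12Decay510.decay510_of_analytic_leaves` with `han : AnalyticOnNhd` weakened to `hdiff : DifferentiableOn`): a family
of finite systems with, on each, the terms 𝐀 ↦ 𝐄^{(j)}(X, exp iξ𝐀) complex-differentiable on (4.4) and bounded by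
(1.18) there, the representation (4.35)/(4.3) of the kernel as the real part of the mixed τ-derivative on the pair of
restricted linearized-minimizer responses, their decay (p. 282), the geometry, cube-sum and domain-sum leaves with
volume-uniform constants, window embeddings of ℤᵈ and the limit (5.1) ⇒ `B12Sec2to5.Decay510 P
(4E₀α₂⁻² B₃² e^{δ₁Mc₁} K₀ K₁) δ₁`, δ₁ = ½ min{δ₀, κM⁻¹}. [cite: Balaban1987RG1, (5.10) p.293] -/
theorem decay510_of_differentiable_leaves {d : ℕ} (Sn : ℕ → LocDomainSys) (Cn : (n : ℕ) → B12.CubeCover (Sn n))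
    (Λn : ℕ → Type*) (Gn : (n : ℕ) → SiteGeometry (Cn n) (Λn n)) (ρn : (n : ℕ) → Λn n → Λn n → ℝ)
    (Wn : ℕ → Type*) [∀ n, NormedAddCommGroup (Wn n)] [∀ n, NormedSpace ℂ (Wn n)]
    (EXn : (n : ℕ) → (Sn n).Dom → Wn n → ℂ) (hn : (n : ℕ) → (Sn n).Dom → Λn n → Wn n)
    (E2n : (n : ℕ) → (Sn n).Dom → Λn n → Λn n → ℝ) (e : (n : ℕ) → (Fin d → ℤ) → Λn n)
    (P : (Fin d → ℤ) → ℝ) {α₂ E₀ B₃ κ δ₀ M c₁ K₀ K₁ : ℝ} (hα₂ : 0 < α₂) (hE₀ : 0 ≤ E₀) (hB₃ : 0 ≤ B₃)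
    (hK₀ : 0 ≤ K₀) (hδ₀ : 0 ≤ δ₀) (hκ : 0 ≤ κ) (hM : 0 < M)
    (hdiff : ∀ n X, DifferentiableOn ℂ (EXn n X) (ball 0 α₂))
    (h118 : ∀ n X, ∀ v ∈ ball (0 : Wn n) α₂, ‖EXn n X v‖ ≤ E₀ * Real.exp (-κ * (Sn n).dj X))
    (hrepr : ∀ n X x y, E2n n X x y = (mixedDeriv (EXn n X) (hn n X x) (hn n X y)).re)
    (hh : ∀ n X x, ‖hn n X x‖ ≤ B₃ * Real.exp (-δ₀ * (Gn n).distD x X))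
    (hgeo : ∀ n, GeomLeaf (Gn n) (ρn n) M c₁) (hcube : ∀ n, CubeSumLeaf (Gn n) (δ₀ / 2) K₁)
    (htree : ∀ n, TreeLeaf (Cn n) (κ / 2) K₀)
    (hρ : ∀ z, ∀ᶠ n in atTop, ρn n (e n 0) (e n z) = B12Sec2to5.l1 z)
    (hlim : ∀ z, Tendsto (fun n => ∑ X, E2n n X (e n 0) (e n z)) atTop (𝓝 (P z))) :
    B12Sec2to5.Decay510 P (4 * E₀ / α₂ ^ 2 * B₃ ^ 2 * Real.exp (delta1 δ₀ κ M * M * c₁) * K₀ * K₁)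
      (delta1 δ₀ κ M) :=
  decay510_of_leaves Sn Cn Λn Gn ρn (fun n _ => Wn n) (fun n X a b => (mixedDeriv (EXn n X) a b).re) hn E2n e P
    (A := 4 * E₀ / α₂ ^ 2) (by positivity) hB₃ hK₀ hδ₀ hκ hM hrepr
    (fun n X a b => qBound_of_differentiableOn (EXn n) hα₂ (hdiff n) (h118 n) X a b) hh hgeo hcube htree hρ hlim

/-! ## §4 Sanity: the new hypotheses are weaker than the old -/

/-- Analytic on the (4.4)-ball ⇒ complex-differentiable there: every instance of the `AnalyticOnNhd` leaf `han` of
`B12Decay510`/`RemainderChainTorus`/`RemainderDecay190` is an instance of the holomorphic-currency leaf `hdiff`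
(Mathlib `AnalyticOnNhd.differentiableOn`; recorded as an `example`, no new declaration). -/
example {E : W → ℂ} {α : ℝ} (hE : AnalyticOnNhd ℂ E (ball 0 α)) : DifferentiableOn ℂ E (ball 0 α) :=
  hE.differentiableOn

end Literature.MathematicalPhysics.QuantumFieldTheory.Balaban1983to89.B12Decay510Holo

end
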